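import Mathlib
import Summits.Ventures.PercRepro.TriangleCapBandLocusLevel

/-!
# PercRepro — THE BAND VALUES ARE PAIRWISE DISTINCT: THE FIRST `T` LAYERS ARE `Σ_{t ≤ T} (t (t + 1) / 2 + 1)` VALUES
(p3, gen 51; part 248)

For `2 s ≥ 4 T + 6 + T (T + 1)` the band values `2 t (s − t − 1) + 2 j` (`t ≤ T`, `2 j ≤ t (t + 1)`) are pairwise
distinct (`band_value_injective`: the band bottoms increase, part 229), so the first `T` layers of the pair-count
spectrum — and of the cherry table (parts 232, 239) — consist of exactly `Σ_{t ≤ T} (t (t + 1) / 2 + 1)` values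
(`card_band_values`: `1 + 2 + 4 + 7 + 11 + 16 + …`).  Axioms: standard.
-/

namespace PercRepro

namespace TriangleCap

namespace C047

open Finset

/-- **THE BAND VALUES ARE DISTINCT** (`t, t' ≤ T`, `2 s ≥ 4 T + 6 + T (T + 1)`, `2 j ≤ t (t + 1)`, `2 j' ≤ t' (t' + 1)`):
`2 t (s − t − 1) + 2 j = 2 t' (s − t' − 1) + 2 j'` forces `t = t'` and `j = j'`. -/
theorem band_value_injective (s T t t' j j' : ℕ) (hT : 4 * T + 6 + T * (T + 1) ≤ 2 * s) (ht : t ≤ T) (ht' : t' ≤ T)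
    (hj : 2 * j ≤ t * (t + 1)) (hj' : 2 * j' ≤ t' * (t' + 1))
    (h : 2 * (t * (s - t - 1)) + 2 * j = 2 * (t' * (s - t' - 1)) + 2 * j') : t = t' ∧ j = j' := by
  have hmono : ∀ u, u ≤ T → 4 * u + 6 + u * (u + 1) ≤ 2 * s := fun u hu => by nlinarith
  rcases lt_trichotomy t t' with hlt | heq | hgt
  · have := band_bottom_lt s t' t hlt (hmono t' ht')
    omega
  · subst heq
    exact ⟨rfl, by omega⟩
  · have := band_bottom_lt s t t' hgt (hmono t ht)
    omega

/-- The band values of the first `T` layers, as a finset of gaps. -/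
def bandValues (s T : ℕ) : Finset ℕ :=
  ((range (T + 1)).sigma (fun t => range (t * (t + 1) / 2 + 1))).image
    (fun p : Σ _ : ℕ, ℕ => 2 * (p.1 * (s - p.1 - 1)) + 2 * p.2)

/-- Membership in the band values. -/
theorem mem_bandValues (s T g : ℕ) :
    g ∈ bandValues s T ↔ ∃ t, t ≤ T ∧ ∃ j, 2 * j ≤ t * (t + 1) ∧ g = 2 * (t * (s - t - 1)) + 2 * j := by
  unfold bandValues
  simp only [mem_image, mem_sigma, mem_range, Sigma.exists]
  constructor
  · rintro ⟨t, j, ⟨ht, hj⟩, rfl⟩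
    refine ⟨t, by omega, j, ?_, rfl⟩
    have h := Nat.even_mul_succ_self t
    obtain ⟨c, hc⟩ := h
    omega
  · rintro ⟨t, ht, j, hj, rfl⟩
    refine ⟨t, j, ⟨by omega, ?_⟩, rfl⟩
    have h := Nat.even_mul_succ_self t
    obtain ⟨c, hc⟩ := h
    omega

/-- **THE NUMBER OF BAND VALUES OF THE FIRST `T` LAYERS** (`2 s ≥ 4 T + 6 + T (T + 1)`):
`#(bandValues s T) = Σ_{t ≤ T} (t (t + 1) / 2 + 1)`. -/
theorem card_bandValues (s T : ℕ) (hT : 4 * T + 6 + T * (T + 1) ≤ 2 * s) :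
    (bandValues s T).card = ∑ t ∈ range (T + 1), (t * (t + 1) / 2 + 1) := by
  unfold bandValues
  rw [card_image_of_injOn, card_sigma]
  · apply sum_congr rfl
    intro t _
    rw [card_range]
  · intro p hp p' hp' h
    simp only [coe_sigma, Set.mem_sigma_iff, coe_range, Set.mem_Iio] at hp hp'
    have hj : 2 * p.2 ≤ p.1 * (p.1 + 1) := by
      obtain ⟨c, hc⟩ := Nat.even_mul_succ_self p.1
      omega
    have hj' : 2 * p'.2 ≤ p'.1 * (p'.1 + 1) := by
      obtain ⟨c, hc⟩ := Nat.even_mul_succ_self p'.1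
      omega
    obtain ⟨h1, h2⟩ := band_value_injective s T p.1 p'.1 p.2 p'.2 hT (by omega) (by omega) hj hj' h
    exact Sigma.ext h1 (heq_of_eq h2)

/-- **THE FIRST FIVE LAYERS ARE FORTY-ONE VALUES** (`28 ≤ s`). -/
theorem card_bandValues_five (s : ℕ) (hs : 28 ≤ s) : (bandValues s 5).card = 41 := by
  rw [card_bandValues s 5 (by omega)]
  decide

end C047

end TriangleCap

end PercRepro
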